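import Mathlib
import Summits.ResolutionOfSingularities.ResolutionOfSingularities.Theorems.FrobeniusLadderFInjectiveMacaulayficationHypersurfaceRegular
import Literature.AlgebraicGeometry.Resolution.RegularLocalRingsQuotient
import HarnessLib

/-!
# [OURS · L1 W4.5(b)] EL♮ helper H-COMB, part 1 — `E`-adapted equations `G = u·ϖ + Xᵢ·h` over a DVR:
# regularity along the exceptional hyperplane, the two traces, flatness

Support file of the crux chain w45b (cell `res-hironaka`, LADDER-RESOLUTION rung L, slot W4.5(b) «dodge
termination: lift to characteristic 0»), working crux **EL♮ = `EquisingularLiftNat`**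
(stmt-ResolutionOfSingularities-20038; bookkeeping node `EquisingularLift` stmt-ResolutionOfSingularities-15660),
research stub `stub_elnat_three` of line `sections` (`L/w45b/EL-NATURAL/SkeletonELnat-v1.lean`), helper **H-COMB
`comb_centre_regular`** of res-L1-w45b-plan-1's CRUX-PLAN v3 §1.7/§4 («the strict transform of a relative line /
curve in an `O`-smooth carrier blown up at sections at `ϖ`-distance 1 is regular with reduced nodal special fibre
`π*Z − Σe`»), filed `--supports stmt-ResolutionOfSingularities-20038` by res-L1-w45b-stub-3. Everything here is
OURS (elementary commutative algebra, kernel-checked); it replaces the role of NOTHING in H. Hironaka's manuscript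
and is NOT a statement of it. AI review is weaker than expert review.

## The algebraic model

Let `O` be a DVR with uniformizer `ϖ`, `k = O/(ϖ)`, and `A = O[X₀, …, X_{n-1}]` the coordinate ring of a chart of
the blow-up of an `O`-smooth carrier `𝔸ⁿ_O` along a section (part 2, file `…EquisingularLiftNatCombCentre`, supplies
the chart substitution `θᵢ : X_j ↦ Xᵢ·X_j (j ≠ i)` and proves that the transform of a hypersurface `V(g)` at
`ϖ`-distance exactly one from the section has an equation of the shape below). An **`E`-adapted equation** is
`G = u·ϖ + Xᵢ·h ∈ A` with `u ∈ Oˣ`: modulo the exceptional hyperplane `E = V(Xᵢ)` the equation IS the uniformizer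
(up to a unit). For such `G` this file proves, in explicit polynomial algebra (pattern of the chain's Δ-toolkit D1 and
of `Theorems/EquisingularLiftEquisingularLiftLinkedNode.lean`):

* `span_pair_eq_of_adapted`, `span_le_of_adapted`, `span_pair_C_eq_of_adapted` — the ideal identities
  `(G, Xᵢ) = (ϖ, Xᵢ)` (so `e := V(ϖ, Xᵢ) ⊆ V(G)`: the exceptional curve LIES ON the centre — the comb) and
  `(G, ϖ) = (Xᵢ·h, ϖ)`;
* `mk_X_mem_nonZeroDivisors_of_adapted`, `mk_C_mem_nonZeroDivisors_of_adapted` — `Xᵢ` and (if `h̄ ≠ 0`) `ϖ` are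
  non-zero-divisors modulo `G` (`E` is Cartier on `V(G)`; no vertical component);
* `nonempty_quotient_X_equiv_of_adapted` — **trace on `E`**: `(A/(G))/(Xᵢ) ≃+* k[X]/(Xᵢ)`, the REDUCED hyperplane:
  `e` has multiplicity one in the special fibre («`π*Z − e`»);
* `nonempty_quotient_C_equiv_of_adapted` — **special fibre**: `(A/(G))/(ϖ) ≃+* k[X]/(Xᵢ·h̄)` (`= e ∪ V(h̄)`);
* `isRegularLocalRing_localization_of_adapted` — **regularity along `E`**: `(A/(G))_Q` is a regular local ring for
  every prime `Q ∋ Xᵢ`. Proof: `Xᵢ` is a non-zero-divisor in the maximal ideal whose quotient is a localization of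
  the regular ring `k[X]/(Xᵢ)` (Jacobian criterion, tree theorem `stub_hypersurfaceRegularOfPderiv`; localization and
  quotient commute, tree theorem `stub_quotLocalizationIso`), so Matsumura's Thm. 19.2 (II) (tree theorem
  `IsRegularLocalRing.of_quotient_span_singleton`) applies;
* `flat_of_adapted` — **flatness**: if `h̄ ≠ 0` then `A/(G)` is torsion-free, hence flat, over the Dedekind domain
  `O` (Mathlib `IsDedekindDomain.flat_iff_torsion_eq_bot`).

Design: no `def`s (pure theorem file); hypotheses are the literal shape `G = C (u*ϖ) + X i * h`; `k` is spelled
`O ⧸ Ideal.span {ϖ}` as in the Δ-toolkit signatures `L/w45b/EL-NATURAL/DeltaCentreSignatures.lean`. Technical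
note for re-users: never re-synthesize `nonZeroDivisors (Localization …)` (the monoid-localization instance is picked
and definitional unfolding times out); regularity of `Xᵢ` in the local ring is proved with `IsLocalization.mk'`.

References (context; the statements are folklore): H. Matsumura, *Commutative Ring Theory*, CUP 1986, Thms. 14.2,
19.2, 30.4; Q. Liu, *Algebraic Geometry and Arithmetic Curves*, OUP 2002, §8.1 (blow-up charts); J. Kollár,
*Lectures on Resolution of Singularities* (2007) §3 (strict transforms under point blow-ups).
-/

set_option linter.dupNamespace false -- mandated namespace of this single-conjunct summit

noncomputable section

namespace Summit.ResolutionOfSingularities.ResolutionOfSingularities.Theorems.EquisingularLiftNat.CombCentre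

open MvPolynomial IsLocalRing

variable {O : Type} [CommRing O]

/-! ## 1. `E`-adapted equations `G = u·ϖ + Xᵢ·h` in `O[X₀, …, X_{n-1}]` -/

section Adapted

variable {n : ℕ} {i : Fin n} {ϖ : O} {u : Oˣ} {h G : MvPolynomial (Fin n) O}

/-- For an `E`-adapted equation `G = u·ϖ + Xᵢ·h` (`u` a unit): the ideals `(G, Xᵢ)` and `(ϖ, Xᵢ)` of
`O[X]` coincide — the exceptional hyperplane `E = V(Xᵢ)` meets `V(G)` exactly in its special fibre
`V(ϖ, Xᵢ)`. [folklore] -/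
theorem span_pair_eq_of_adapted (hG : G = C ((u : O) * ϖ) + X i * h) :
    Ideal.span {G, X i} = Ideal.span {C ϖ, X i} := by
  have hu : C ((↑u⁻¹ : O)) * C ((u : O)) = (1 : MvPolynomial (Fin n) O) := by
    rw [← map_mul, Units.inv_mul, map_one]
  apply le_antisymm
  · rw [Ideal.span_le, Set.insert_subset_iff, Set.singleton_subset_iff]
    refine ⟨Ideal.mem_span_pair.mpr ⟨C (u : O), h, ?_⟩, Ideal.subset_span (by simp)⟩
    rw [hG, map_mul]; ring
  · rw [Ideal.span_le, Set.insert_subset_iff, Set.singleton_subset_iff]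
    refine ⟨Ideal.mem_span_pair.mpr ⟨C (↑u⁻¹ : O), -(C (↑u⁻¹ : O) * h), ?_⟩,
      Ideal.subset_span (by simp)⟩
    rw [hG, map_mul]
    linear_combination (C ϖ) * hu

/-- For an `E`-adapted equation: `(G) ≤ (ϖ, Xᵢ)`, i.e. the special fibre `V(ϖ, Xᵢ)` of the exceptional
hyperplane lies on the hypersurface `V(G)`. [folklore] -/
theorem span_le_of_adapted (hG : G = C ((u : O) * ϖ) + X i * h) :
    Ideal.span {G} ≤ Ideal.span {C ϖ, X i} := by
  rw [← span_pair_eq_of_adapted hG]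
  exact Ideal.span_mono (Set.singleton_subset_iff.mpr (Set.mem_insert _ _))

/-- For an `E`-adapted equation: `(G, ϖ) = (Xᵢ·h, ϖ)` — the special fibre of `V(G)` is cut out by
`Xᵢ·h̄`. [folklore] -/
theorem span_pair_C_eq_of_adapted (hG : G = C ((u : O) * ϖ) + X i * h) :
    Ideal.span {G, C ϖ} = Ideal.span {X i * h, C ϖ} := by
  apply le_antisymm
  · rw [Ideal.span_le, Set.insert_subset_iff, Set.singleton_subset_iff]
    refine ⟨Ideal.mem_span_pair.mpr ⟨1, C (u : O), ?_⟩, Ideal.subset_span (by simp)⟩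
    rw [hG, map_mul]; ring
  · rw [Ideal.span_le, Set.insert_subset_iff, Set.singleton_subset_iff]
    refine ⟨Ideal.mem_span_pair.mpr ⟨1, -C (u : O), ?_⟩, Ideal.subset_span (by simp)⟩
    rw [hG, map_mul]; ring

/-- `Xᵢ` does not divide an `E`-adapted equation (`O` a domain, `ϖ ≠ 0`): its constant term `u·ϖ`
is non-zero. [folklore] -/
theorem not_X_dvd_of_adapted [IsDomain O] (hϖ0 : ϖ ≠ 0) (hG : G = C ((u : O) * ϖ) + X i * h) :
    ¬ X i ∣ G := by
  intro hd
  rw [hG, dvd_add_left (dvd_mul_right _ _)] at hd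
  obtain ⟨q, hq⟩ := hd
  have := congrArg (coeff 0) hq
  simp only [coeff_C, if_true, coeff_X_mul', Finsupp.support_zero, Finset.notMem_empty,
    if_false] at this
  exact mul_ne_zero (Units.ne_zero u) hϖ0 this

/-- In a domain `A`, a prime element `π` not dividing `G` is a non-zero-divisor modulo `G`.
[folklore] -/
theorem mk_mem_nonZeroDivisors_of_prime_of_not_dvd {A : Type*} [CommRing A] [IsDomain A] {π G : A}
    (hπ : Prime π) (hπG : ¬ π ∣ G) :
    Ideal.Quotient.mk (Ideal.span {G}) π ∈ nonZeroDivisors (A ⧸ Ideal.span {G}) := by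
  rw [mem_nonZeroDivisors_iff_right]
  intro a ha
  obtain ⟨a, rfl⟩ := Ideal.Quotient.mk_surjective a
  rw [← map_mul, Ideal.Quotient.eq_zero_iff_mem, Ideal.mem_span_singleton] at ha
  rw [Ideal.Quotient.eq_zero_iff_mem, Ideal.mem_span_singleton]
  obtain ⟨b, hb⟩ := ha
  have hdvd : π ∣ G * b := ⟨a, by rw [← hb, mul_comm]⟩
  rcases hπ.dvd_or_dvd hdvd with h1 | ⟨c, rfl⟩
  · exact absurd h1 hπG
  · refine ⟨c, mul_right_cancel₀ hπ.ne_zero ?_⟩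
    rw [hb]; ring

/-- For an `E`-adapted equation over a domain, `Xᵢ` is a non-zero-divisor modulo `G`: the
exceptional hyperplane is a CARTIER divisor on `V(G)` (no component of `V(G)` lies in `E`).
[folklore] -/
theorem mk_X_mem_nonZeroDivisors_of_adapted [IsDomain O] (hϖ0 : ϖ ≠ 0)
    (hG : G = C ((u : O) * ϖ) + X i * h) :
    Ideal.Quotient.mk (Ideal.span {G}) (X i) ∈
      nonZeroDivisors (MvPolynomial (Fin n) O ⧸ Ideal.span {G}) :=
  mk_mem_nonZeroDivisors_of_prime_of_not_dvd X_prime (not_X_dvd_of_adapted hϖ0 hG)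

/-- `C ϖ ∣ p` iff the coefficientwise reduction `p̄ ∈ k[X]` vanishes. [folklore] -/
theorem C_dvd_iff_map_eq_zero (ϖ : O) (p : MvPolynomial (Fin n) O) :
    C ϖ ∣ p ↔ MvPolynomial.map (Ideal.Quotient.mk (Ideal.span {ϖ})) p = 0 := by
  rw [C_dvd_iff_dvd_coeff, MvPolynomial.ext_iff]
  refine forall_congr' fun m => ?_
  rw [coeff_map, coeff_zero, Ideal.Quotient.eq_zero_iff_mem, Ideal.mem_span_singleton]

/-- `ϖ` does not divide an `E`-adapted equation `G = u·ϖ + Xᵢ·h` as soon as `h̄ ≠ 0` (`ϖ` prime):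
`V(G)` has no vertical component. [folklore] -/
theorem not_C_dvd_of_adapted [IsDomain O] (hϖ : Prime ϖ) (hG : G = C ((u : O) * ϖ) + X i * h)
    (hh : MvPolynomial.map (Ideal.Quotient.mk (Ideal.span {ϖ})) h ≠ 0) : ¬ C ϖ ∣ G := by
  have hC : Prime (C ϖ : MvPolynomial (Fin n) O) := (prime_C_iff (Fin n)).mpr hϖ
  intro hd
  rw [hG, map_mul, mul_comm (C (u : O)), dvd_add_right (dvd_mul_right _ _)] at hd
  rcases hC.dvd_or_dvd hd with hX | hh'
  · rw [C_dvd_iff_map_eq_zero, map_X] at hX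
    haveI : Nontrivial (O ⧸ Ideal.span {ϖ}) :=
      Ideal.Quotient.nontrivial_iff.mpr ((Ideal.span_singleton_ne_top) hϖ.not_unit)
    exact X_ne_zero i hX
  · exact hh ((C_dvd_iff_map_eq_zero ϖ h).mp hh')

/-- For an `E`-adapted equation with `h̄ ≠ 0` over a domain with `ϖ` prime, `ϖ` is a non-zero-divisor
modulo `G`. [folklore] -/
theorem mk_C_mem_nonZeroDivisors_of_adapted [IsDomain O] (hϖ : Prime ϖ)
    (hG : G = C ((u : O) * ϖ) + X i * h)
    (hh : MvPolynomial.map (Ideal.Quotient.mk (Ideal.span {ϖ})) h ≠ 0) :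
    Ideal.Quotient.mk (Ideal.span {G}) (C ϖ) ∈
      nonZeroDivisors (MvPolynomial (Fin n) O ⧸ Ideal.span {G}) :=
  mk_mem_nonZeroDivisors_of_prime_of_not_dvd ((prime_C_iff (Fin n)).mpr hϖ)
    (not_C_dvd_of_adapted hϖ hG hh)

/-- **H-COMB, flatness.** For an `E`-adapted equation `G = u·ϖ + Xᵢ·h` with `h̄ ≠ 0` over a DVR `O`
with uniformizer `ϖ`, the hypersurface ring `O[X]/(G)` is torsion-free, hence FLAT, over `O`: `V(G)`
is `O`-flat (no vertical component). [folklore] -/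
theorem flat_of_adapted [IsDomain O] [IsDiscreteValuationRing O] (hϖ : Irreducible ϖ)
    (hG : G = C ((u : O) * ϖ) + X i * h)
    (hh : MvPolynomial.map (Ideal.Quotient.mk (Ideal.span {ϖ})) h ≠ 0) :
    Module.Flat O (MvPolynomial (Fin n) O ⧸ Ideal.span {G}) := by
  have hϖp : Prime ϖ := hϖ.prime
  have h0 := mk_C_mem_nonZeroDivisors_of_adapted hϖp hG hh
  -- `ϖ` acts injectively
  have hreg : IsSMulRegular (MvPolynomial (Fin n) O ⧸ Ideal.span {G}) ϖ := by
    intro a b hab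
    dsimp only at hab
    rw [← algebraMap_smul (MvPolynomial (Fin n) O ⧸ Ideal.span {G}) ϖ a,
      ← algebraMap_smul (MvPolynomial (Fin n) O ⧸ Ideal.span {G}) ϖ b, smul_eq_mul, smul_eq_mul,
      ← Ideal.Quotient.mk_algebraMap, MvPolynomial.algebraMap_eq] at hab
    exact (mul_cancel_left_mem_nonZeroDivisors h0).mp hab
  -- every non-zero `r = w·ϖᵐ` acts injectively: torsion-free over the Dedekind domain `O`, hence flat
  haveI : Module.IsTorsionFree O (MvPolynomial (Fin n) O ⧸ Ideal.span {G}) := by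
    refine ⟨fun r hr => ?_⟩
    obtain ⟨m, w, hw⟩ := IsDiscreteValuationRing.associated_pow_irreducible hr.ne_zero hϖ
    -- `hw : r * w = ϖ ^ m`
    have hpow : IsSMulRegular (MvPolynomial (Fin n) O ⧸ Ideal.span {G}) ((w : O) * r) := by
      rw [mul_comm, hw]; exact hreg.pow m
    exact hpow.of_mul
  infer_instance

end Adapted

/-! ## 2. Reduction modulo `ϖ`: `O[X]/(ϖ) ≃ k[X]` and the two trace identifications -/

section Reduction

variable {n : ℕ} {i : Fin n} {ϖ : O} {u : Oˣ} {h G : MvPolynomial (Fin n) O}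

/-- The reduction isomorphism `O[X]/(ϖ) ≃+* k[X]`, `k = O/(ϖ)`, together with its value on residue
classes: the class of `p` goes to the coefficientwise reduction `p̄`. (Mathlib's
`MvPolynomial.quotientEquivQuotientMvPolynomial`, repackaged.) [folklore] -/
theorem exists_quotient_C_equiv (ϖ : O) :
    ∃ f : (MvPolynomial (Fin n) O ⧸ Ideal.span {(C ϖ : MvPolynomial (Fin n) O)}) ≃+*
        MvPolynomial (Fin n) (O ⧸ Ideal.span {ϖ}),
      ∀ p, f (Ideal.Quotient.mk _ p) = MvPolynomial.map (Ideal.Quotient.mk (Ideal.span {ϖ})) p := by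
  have hC : Ideal.span {(C ϖ : MvPolynomial (Fin n) O)} = (Ideal.span {ϖ}).map C := by
    rw [Ideal.map_span, Set.image_singleton]
  let e := MvPolynomial.quotientEquivQuotientMvPolynomial (σ := Fin n) (Ideal.span {ϖ})
  -- `e (p̄) = [p]` : two ring maps `O[X] → O[X]/(ϖ)` agreeing on `C` and `X`
  have key : ∀ p : MvPolynomial (Fin n) O,
      e (MvPolynomial.map (Ideal.Quotient.mk (Ideal.span {ϖ})) p) = Ideal.Quotient.mk _ p := by
    intro p
    have hcomp : (e.toAlgHom.toRingHom.comp
        (MvPolynomial.map (Ideal.Quotient.mk (Ideal.span {ϖ})))) =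
        Ideal.Quotient.mk ((Ideal.span {ϖ}).map C) := by
      refine MvPolynomial.ringHom_ext (fun a => ?_) (fun j => ?_)
      · simp only [RingHom.coe_comp, Function.comp_apply, map_C]
        exact e.commutes a
      · simp only [RingHom.coe_comp, Function.comp_apply, map_X]
        simp [e, MvPolynomial.quotientEquivQuotientMvPolynomial]
    exact congrArg (fun φ : MvPolynomial (Fin n) O →+* _ => φ p) hcomp
  refine ⟨(Ideal.quotEquivOfEq hC).trans e.symm.toRingEquiv, fun p => ?_⟩
  simp only [RingEquiv.coe_trans, Function.comp_apply, Ideal.quotEquivOfEq_mk,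
    AlgEquiv.coe_ringEquiv]
  rw [AlgEquiv.symm_apply_eq]
  exact (key p).symm

/-- **Trace on the exceptional divisor.** For an `E`-adapted equation `G = u·ϖ + Xᵢ·h`, the
scheme-theoretic intersection `V(G) ∩ E` is the REDUCED coordinate hyperplane of the special fibre:
`(O[X]/(G))/(Xᵢ) ≃+* k[X]/(Xᵢ)`. [folklore] -/
theorem nonempty_quotient_X_equiv_of_adapted (hG : G = C ((u : O) * ϖ) + X i * h) :
    Nonempty (((MvPolynomial (Fin n) O ⧸ Ideal.span {G}) ⧸
        Ideal.span {Ideal.Quotient.mk (Ideal.span {G}) (X i)}) ≃+*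
      (MvPolynomial (Fin n) (O ⧸ Ideal.span {ϖ}) ⧸
        Ideal.span {(X i : MvPolynomial (Fin n) (O ⧸ Ideal.span {ϖ}))})) := by
  obtain ⟨f, hf⟩ := exists_quotient_C_equiv (n := n) ϖ
  -- `(A/(G))/(Xᵢ) ≃ A/((G) ⊔ (Xᵢ)) = A/((ϖ) ⊔ (Xᵢ)) ≃ (A/(ϖ))/(Xᵢ) ≃ k[X]/(Xᵢ)`
  have h1 : Ideal.span {G} ⊔ Ideal.span {X i} =
      Ideal.span {(C ϖ : MvPolynomial (Fin n) O)} ⊔ Ideal.span {X i} := by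
    rw [← Ideal.span_insert, ← Ideal.span_insert, span_pair_eq_of_adapted hG]
  have hJ : Ideal.span {(X i : MvPolynomial (Fin n) (O ⧸ Ideal.span {ϖ}))} =
      Ideal.map (f : _ →+* _) (Ideal.map (Ideal.Quotient.mk (Ideal.span {C ϖ}))
        (Ideal.span {(X i : MvPolynomial (Fin n) O)})) := by
    rw [Ideal.map_map, Ideal.map_span, Set.image_singleton, RingHom.coe_comp, Function.comp_apply,
      RingHom.coe_coe, hf, map_X]
  exact ⟨(Ideal.quotEquivOfEq (by rw [Ideal.map_span, Set.image_singleton])).trans <|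
    (DoubleQuot.quotQuotEquivQuotSup (Ideal.span {G}) (Ideal.span {X i})).trans <|
    (Ideal.quotEquivOfEq h1).trans <|
    (DoubleQuot.quotQuotEquivQuotSup (Ideal.span {C ϖ}) (Ideal.span {X i})).symm.trans <|
    Ideal.quotientEquiv _ _ f hJ⟩

/-- **Special fibre.** For an `E`-adapted equation `G = u·ϖ + Xᵢ·h`, the special fibre of `V(G)`
is `V(Xᵢ·h̄) ⊂ 𝔸ⁿ_k`: `(O[X]/(G))/(ϖ) ≃+* k[X]/(Xᵢ·h̄)`, `h̄` the reduction of `h`. [folklore] -/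
theorem nonempty_quotient_C_equiv_of_adapted (hG : G = C ((u : O) * ϖ) + X i * h) :
    Nonempty (((MvPolynomial (Fin n) O ⧸ Ideal.span {G}) ⧸
        Ideal.span {Ideal.Quotient.mk (Ideal.span {G}) (C ϖ)}) ≃+*
      (MvPolynomial (Fin n) (O ⧸ Ideal.span {ϖ}) ⧸
        Ideal.span {X i * MvPolynomial.map (Ideal.Quotient.mk (Ideal.span {ϖ})) h})) := by
  obtain ⟨f, hf⟩ := exists_quotient_C_equiv (n := n) ϖ
  have h1 : Ideal.span {G} ⊔ Ideal.span {(C ϖ : MvPolynomial (Fin n) O)} =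
      Ideal.span {(C ϖ : MvPolynomial (Fin n) O)} ⊔ Ideal.span {X i * h} := by
    rw [← Ideal.span_insert, ← Ideal.span_insert, span_pair_C_eq_of_adapted hG,
      Ideal.span_pair_comm]
  have hJ : Ideal.span {X i * MvPolynomial.map (Ideal.Quotient.mk (Ideal.span {ϖ})) h} =
      Ideal.map (f : _ →+* _) (Ideal.map (Ideal.Quotient.mk (Ideal.span {C ϖ}))
        (Ideal.span {X i * h})) := by
    rw [Ideal.map_map, Ideal.map_span, Set.image_singleton, RingHom.coe_comp, Function.comp_apply,
      RingHom.coe_coe, hf, map_mul, map_X]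
  exact ⟨(Ideal.quotEquivOfEq (by rw [Ideal.map_span, Set.image_singleton])).trans <|
    (DoubleQuot.quotQuotEquivQuotSup (Ideal.span {G}) (Ideal.span {C ϖ})).trans <|
    (Ideal.quotEquivOfEq h1).trans <|
    (DoubleQuot.quotQuotEquivQuotSup (Ideal.span {C ϖ}) (Ideal.span {X i * h})).symm.trans <|
    Ideal.quotientEquiv _ _ f hJ⟩

end Reduction

/-! ## 3. Regularity of `V(G)` along the exceptional hyperplane -/

section Regular

variable {n : ℕ} {i : Fin n} {ϖ : O} {u : Oˣ} {h G : MvPolynomial (Fin n) O}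

/-- Over a field `k`, the hyperplane ring `k[X₀, …, X_{n-1}]/(Xᵢ)` is a regular ring (Jacobian
criterion with `∂Xᵢ/∂Xᵢ = 1`, tree theorem `stub_hypersurfaceRegularOfPderiv`). [folklore] -/
theorem isRegularRing_quotient_X (k : Type) [Field k] (n : ℕ) (i : Fin n) :
    IsRegularRing (MvPolynomial (Fin n) k ⧸ Ideal.span {(X i : MvPolynomial (Fin n) k)}) := by
  refine isRegularRing_iff.mpr fun Q _ => ?_
  refine FInjectiveMacaulayfication.HypersurfaceRegular.stub_hypersurfaceRegularOfPderiv k n (X i) i Q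
    fun h1 => ?_
  rw [pderiv_X_self] at h1
  exact (Ideal.comap_isPrime (Ideal.Quotient.mk (Ideal.span {(X i : MvPolynomial (Fin n) k)})) Q).ne_top
    ((Ideal.eq_top_iff_one _).mpr h1)

/-- For an `E`-adapted equation `G = u·ϖ + Xᵢ·h` over a DVR `O` with uniformizer `ϖ`, the trace ring
`(O[X]/(G))/(Xᵢ) ≃ k[X]/(Xᵢ)` is a regular ring. [folklore] -/
theorem isRegularRing_quotient_X_of_adapted [IsDomain O] [IsDiscreteValuationRing O]
    (hϖ : Irreducible ϖ) (hG : G = C ((u : O) * ϖ) + X i * h) :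
    IsRegularRing ((MvPolynomial (Fin n) O ⧸ Ideal.span {G}) ⧸
      Ideal.span {Ideal.Quotient.mk (Ideal.span {G}) (X i)}) := by
  haveI : (Ideal.span {ϖ}).IsMaximal := by
    rw [← hϖ.maximalIdeal_eq]; exact IsLocalRing.maximalIdeal.isMaximal O
  letI : Field (O ⧸ Ideal.span {ϖ}) := Ideal.Quotient.field _
  obtain ⟨e⟩ := nonempty_quotient_X_equiv_of_adapted hG
  haveI := isRegularRing_quotient_X (O ⧸ Ideal.span {ϖ}) n i
  exact IsRegularRing.of_ringEquiv
    (R := MvPolynomial (Fin n) (O ⧸ Ideal.span {ϖ}) ⧸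
      Ideal.span {(X i : MvPolynomial (Fin n) (O ⧸ Ideal.span {ϖ}))}) e.symm

/-- **H-COMB, regularity along `E`.** For an `E`-adapted equation `G = u·ϖ + Xᵢ·h` over a DVR `O`
with uniformizer `ϖ` (`u` a unit), the hypersurface ring `O[X]/(G)` is a regular local ring at every
prime containing `Xᵢ` — i.e. `V(G)` is regular at every point of `V(G) ∩ E = V(ϖ, Xᵢ)`. Proof: `Xᵢ` is
a non-zero-divisor modulo `G` lying in the maximal ideal of the local ring, and the quotient by it is a
localization of the regular ring `k[X]/(Xᵢ)`; conclude by Matsumura Thm. 19.2 (II) (tree theorem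
`IsRegularLocalRing.of_quotient_span_singleton`). [folklore] -/
theorem isRegularLocalRing_localization_of_adapted [IsDomain O] [IsDiscreteValuationRing O]
    (hϖ : Irreducible ϖ) (hG : G = C ((u : O) * ϖ) + X i * h)
    (Q : Ideal (MvPolynomial (Fin n) O ⧸ Ideal.span {G})) [Q.IsPrime]
    (hQ : Ideal.Quotient.mk (Ideal.span {G}) (X i) ∈ Q) :
    IsRegularLocalRing (Localization.AtPrime Q) := by
  -- `x := [Xᵢ]` is a non-zero-divisor of `B := O[X]/(G)`, hence of the localization
  have hx0 := mk_X_mem_nonZeroDivisors_of_adapted hϖ.ne_zero hG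
  have hreg : IsSMulRegular (Localization.AtPrime Q)
      (algebraMap (MvPolynomial (Fin n) O ⧸ Ideal.span {G}) (Localization.AtPrime Q)
        (Ideal.Quotient.mk (Ideal.span {G}) (X i))) := by
    -- direct fraction computation (the localization is flat over `B`)
    intro a b hab
    obtain ⟨⟨a, sa⟩, rfl⟩ := IsLocalization.mk'_surjective Q.primeCompl a
    obtain ⟨⟨b, sb⟩, rfl⟩ := IsLocalization.mk'_surjective Q.primeCompl b
    have hab' : algebraMap _ (Localization.AtPrime Q) (Ideal.Quotient.mk (Ideal.span {G}) (X i)) *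
        IsLocalization.mk' _ a sa =
      algebraMap _ (Localization.AtPrime Q) (Ideal.Quotient.mk (Ideal.span {G}) (X i)) *
        IsLocalization.mk' _ b sb := hab
    rw [IsLocalization.mul_mk'_eq_mk'_of_mul, IsLocalization.mul_mk'_eq_mk'_of_mul,
      IsLocalization.mk'_eq_iff_eq, IsLocalization.eq_iff_exists Q.primeCompl] at hab'
    obtain ⟨c, hc⟩ := hab'
    rw [IsLocalization.mk'_eq_iff_eq, IsLocalization.eq_iff_exists Q.primeCompl]
    refine ⟨c, (mul_cancel_left_mem_nonZeroDivisors hx0).mp ?_⟩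
    linear_combination hc
  have hxm : algebraMap (MvPolynomial (Fin n) O ⧸ Ideal.span {G}) (Localization.AtPrime Q)
      (Ideal.Quotient.mk (Ideal.span {G}) (X i)) ∈ maximalIdeal (Localization.AtPrime Q) := by
    rw [← Localization.AtPrime.map_eq_maximalIdeal]
    exact Ideal.mem_map_of_mem _ hQ
  -- the quotient by `x` is the localization of `B/(x) ≃ k[X]/(Xᵢ)` at the image `Q'` of `Q`
  have hker : RingHom.ker (Ideal.Quotient.mk
      (Ideal.span {Ideal.Quotient.mk (Ideal.span {G}) (X i)})) ≤ Q := by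
    rw [Ideal.mk_ker]
    exact (Ideal.span_singleton_le_iff_mem _).mpr hQ
  haveI hQ' : (Q.map (Ideal.Quotient.mk
      (Ideal.span {Ideal.Quotient.mk (Ideal.span {G}) (X i)}))).IsPrime :=
    Ideal.map_isPrime_of_surjective Ideal.Quotient.mk_surjective hker
  have hQ'c : (Q.map (Ideal.Quotient.mk _)).comap
      (Ideal.Quotient.mk (Ideal.span {Ideal.Quotient.mk (Ideal.span {G}) (X i)})) = Q := by
    rw [Ideal.comap_map_of_surjective _ Ideal.Quotient.mk_surjective, ← RingHom.ker_eq_comap_bot,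
      sup_eq_left.mpr hker]
  obtain ⟨e⟩ := FInjectiveMacaulayfication.QuotLocalizationIso.stub_quotLocalizationIso
    (MvPolynomial (Fin n) O ⧸ Ideal.span {G}) (Ideal.Quotient.mk (Ideal.span {G}) (X i)) Q
    (Q.map (Ideal.Quotient.mk _)) hQ'c
  haveI := isRegularRing_quotient_X_of_adapted hϖ hG
  haveI := IsRegularLocalRing.of_ringEquiv e.symm
  haveI : IsNoetherianRing (Localization.AtPrime Q) :=
    IsLocalization.isNoetherianRing Q.primeCompl _ inferInstance
  exact Literature.AlgebraicGeometry.Resolution.IsRegularLocalRing.of_quotient_span_singleton hxm hreg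

end Regular

end Summit.ResolutionOfSingularities.ResolutionOfSingularities.Theorems.EquisingularLiftNat.CombCentre

end
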